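import Summits.BirchSwinnertonDyer.BirchSwinnertonDyer.Theorems.KolyvaginDepthDoorDepthTableSteinWuthrichEvenRankBSDQuotient
import Summits.BirchSwinnertonDyer.BirchSwinnertonDyer.Theorems.KolyvaginDepthDoorDepthTableRowsTwoSha1
import HarnessLib

/-!
# Route `KolyvaginDepthDoor`, crux `KolyvaginDepthSupplyKN` (stmt-BirchSwinnertonDyer-22820) —
# DEPTH TABLE v15, GENERIC (exact form): for a rank-one twist, «`#Sel_p(T) ≤ p`» ⟺ «the BSD quotient of `T` is a `p`-adic unit»
# (Burungale–Castella–Skinner 2025 Cor. 1.3.1 + Gross–Zagier–Kolyvagin BY NAME)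

Helper file of the lead prover of line `levelone` (kdd-p1 g19; `--supports stmt-BirchSwinnertonDyer-22820
--as helper`); it closes nothing and BSD is NOT proved by it.

`…EvenRankBSDQuotient` (p726884) gives the direction the crux needs: BSD quotient `p`-integral-free ⟹ `#Sel_p(T) = p`. The v13 rows
of the depth table are BICONDITIONALS («one Kolyvagin bit ⟺ `#Sel_p(E^{(d_K)}) ≤ p`»), so the honest even-rank reading is a
biconditional too. This file proves it once, for any rank-one `T`:

* `not_dvd_natCard_sha_of_sha_inf_torsionBy_eq_bot` — Cauchy: for finite `Ш`, `Ш[p] = 0 ⟹ p ∤ #Ш` (converse of the lineage's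
  `sha_inf_torsionBy_eq_bot_of_not_dvd_natCard`).
* `natCard_selmerGroup_le_iff_bsdQuotient_unit_bcs` — **for `T/ℚ` globally minimal, non-CM, `p ≥ 5` good ordinary, `ρ̄_{T,p}` onto,
  Kodaira–Néron at `p`, `ord_{s=1} L(T,s) = 1`:  `#Sel_p(T/ℚ) ≤ p` ⟺ `∃ q ∈ ℚ, L'(T,1)/(Ω_T·Reg_T) = q ∧ ord_p q = 0`.**
  (`→`: GZK rank `1` + AEC X.4.2 give `Ш(T)[p] = 0` (`natCard_selmerGroup_le_iff_rank_eq_one_sha₁₅`), Cauchy gives `p ∤ #Ш(T)`, BCS's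
  identity `ord_p q = ord_p #Ш + ord_p Tam` and Kodaira–Néron give `ord_p q = 0`; `←`: the quotient determines `q` (`ℚ ↪ ℂ`), and
  `natCard_selmerGroup_eq_pow_of_padicVal_printShape`.)

So, modulo print and `r_an(T) = 1`, ONE JETCHEV–LAUTER–STEIN BIT at a rank-two curve IS the `p`-adic unit-ness of `#Ш_an(T)·Tam(T)` of its
rank-one Heegner twist — the cyclotomic/anticyclotomic AGREEMENT instrument of the route in its sharpest per-curve form. CONDITIONAL on the
two named facts; per `(T, p)`; nothing class-wide; BSD is NOT proved by it.

References: [BurungaleCastellaSkinner2025] Cor. 1.3.1 (p. 4); [Darmon2004] Thm. 3.22; [SilvermanAEC2009] X.4.2, C.15.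
-/

set_option linter.dupNamespace false

noncomputable section

open scoped Classical NumberField

namespace Summit.BirchSwinnertonDyer.BirchSwinnertonDyer.Theorems.KolyvaginDepthDoor

open Literature.NumberTheory.EllipticCurves Literature.NumberTheory.EllipticCurves.ModularForms
  WeierstrassCurve NumberField IsDedekindDomain
open Literature.NumberTheory.EllipticCurves.Rank1Residual
open Summit.BirchSwinnertonDyer.BirchSwinnertonDyer.Theorems

/-- **Cauchy: a finite `Ш` with `Ш[p] = 0` has order prime to `p`** (an element of order `p` would lie in `Ш ⊓ H¹[p]`).
Converse of `sha_inf_torsionBy_eq_bot_of_not_dvd_natCard`. [folklore] -/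
theorem not_dvd_natCard_sha_of_sha_inf_torsionBy_eq_bot (V : WeierstrassCurve ℚ) [V.IsElliptic] (p : ℕ)
    [hp : Fact p.Prime] [Finite V.sha]
    (h : (V.sha ⊓ AddSubgroup.torsionBy V.galH1 (p : ℤ) : AddSubgroup V.galH1) = ⊥) :
    ¬ p ∣ Nat.card V.sha := by
  intro hdvd
  obtain ⟨t, ht⟩ := exists_prime_addOrderOf_dvd_card' (G := V.sha) p hdvd
  have h0 : p • t = 0 := by rw [← ht]; exact addOrderOf_nsmul_eq_zero t
  have h1 : p • (t : V.galH1) = 0 := by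
    have := congrArg Subtype.val h0
    simpa using this
  have hmem : (t : V.galH1) ∈ (V.sha ⊓ AddSubgroup.torsionBy V.galH1 (p : ℤ) : AddSubgroup V.galH1) :=
    AddSubgroup.mem_inf.mpr ⟨t.2, AddSubgroup.torsionBy.nsmul_iff.mpr h1⟩
  rw [h, AddSubgroup.mem_bot] at hmem
  have ht0 : t = 0 := Subtype.ext hmem
  rw [ht0, addOrderOf_zero] at ht
  exact hp.out.one_lt.ne ht

/-- **Exact even-rank reading (generic): `#Sel_p(T) ≤ p` ⟺ the BSD quotient of the rank-one curve `T` is a `p`-adic unit.**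
`T/ℚ` globally minimal and non-CM; `p ≥ 5` good ordinary; `ρ̄_{T,p}` onto; Kodaira–Néron at `p`; `ord_{s=1} L(T,s) = 1`. THEN
`#Sel_p(T/ℚ) ≤ p ↔ ∃ q : ℚ, L'(T,1)/(Ω_T·Reg_T) = q ∧ ord_p q = 0`. (GZK: rank `T = 1`, `Ш(T)` finite; BCS Cor. 1.3.1:
`L'(T,1)/(Ω_T Reg_T) = q` with `ord_p q = ord_p #Ш(T) + ord_p Tam(T)`; Kodaira–Néron: `ord_p Tam(T) = 0`; `→` by AEC X.4.2
(`natCard_selmerGroup_le_iff_rank_eq_one_sha₁₅`) and Cauchy; `←` by `natCard_selmerGroup_eq_pow_of_padicVal_printShape`.) CONDITIONAL on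
the two named facts; per `(T, p)`; BSD is not proved by it. [cite: BurungaleCastellaSkinner2025, Cor. 1.3.1 (p. 4)] [cite: Darmon2004, Thm. 3.22]
[cite: SilvermanAEC2009, Thm. X.4.2] -/
theorem natCard_selmerGroup_le_iff_bsdQuotient_unit_bcs
    (hBCS : BurungaleCastellaSkinner2025.cor131_padicValRat_bsd_rank_le_one)
    (hGZK : rank_eq_analyticRank_of_analyticRank_le_one)
    (T : WeierstrassCurve ℚ) [T.IsElliptic] [T.IsGloballyMinimal] (p : ℕ) [hp : Fact p.Prime] (h5 : 5 ≤ p)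
    (hcm : ¬ T.HasCM) (hgood : T.HasGoodReductionAtPrime p) (hord : ¬ (p : ℤ) ∣ T.frobeniusTrace p)
    (hsur : T.HasSurjectiveModNGaloisRep p)
    (hKN : ∀ v : HeightOneSpectrum (𝓞 ℚ), T.HasMultiplicativeReductionAt v → ¬ p ∣ T.ordMinimalDiscriminant v)
    (hr : T.analyticRank = 1) :
    Nat.card (T.selmerGroup p) ≤ p ↔
      ∃ q : ℚ, T.leadingLCoeff / ((T.realPeriodRat * T.regulator : ℝ) : ℂ) = (q : ℂ) ∧ padicValRat p q = 0 := by
  have hirr : T.HasIrreducibleModPGaloisRep p := hasIrreducibleModPGaloisRep_of_hasSurjectiveModNGaloisRep T p hsur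
  have him : BigIm T p := Summit.BirchSwinnertonDyer.Rank1Residual.X9.bigIm_of_surj T p h5 hsur
  obtain ⟨hrank, hfin⟩ := hGZK T (by rw [hr])
  rw [hr] at hrank
  haveI : Finite T.sha := hfin
  obtain ⟨q, hq, hv⟩ := hBCS T p hcm (by omega) ⟨hgood, hord⟩ hirr him (by rw [hr]) hfin
  have htam0 : padicValNat p T.tamagawaProduct = 0 :=
    padicValNat.eq_zero_of_not_dvd (not_dvd_tamagawaProduct_of_kodairaNeron T p h5 hKN)
  constructor
  · intro hle
    have hbot := ((natCard_selmerGroup_le_iff_rank_eq_one_sha₁₅ T p hirr (by rw [hrank])).mp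
      (by exact_mod_cast hle)).2
    have hnd : ¬ p ∣ T.shaOrder := by
      rw [WeierstrassCurve.shaOrder]; exact not_dvd_natCard_sha_of_sha_inf_torsionBy_eq_bot T p hbot
    have hsha0 : padicValNat p T.shaOrder = 0 := padicValNat.eq_zero_of_not_dvd hnd
    exact ⟨q, hq, by rw [hv, hsha0, htam0]; norm_num⟩
  · rintro ⟨q', hq', hv'⟩
    have hqq : q = q' := by
      have h := hq.symm.trans hq'
      exact_mod_cast h
    have hv0 : padicValRat p q ≤ 0 := by rw [hqq, hv']
    rw [natCard_selmerGroup_eq_pow_of_padicVal_printShape T p h5 hirr hKN hfin hv hv0, hrank, pow_one]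

end Summit.BirchSwinnertonDyer.BirchSwinnertonDyer.Theorems.KolyvaginDepthDoor

end
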